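import Summits.Ventures.YMGap.YM3IR.BalabanCeilings
import Summits.Ventures.YMGap.YM3IR.BalabanCeilingsSU3PV2
import Summits.Ventures.YMGap.RobustBall.StarRowsSU3PV2WDim3
import HarnessLib

/-!
# YM3IR / BalabanCeilingsSU3PV2W — the §Y4 sentence for `SU(3)` on the TIER-2 (weighted, infinite-range) ball at engine-2's
HYPOTHESIS-FREE PV2-star W rows (Wilson `β_W = 1/2` at rate `1/100`; `β_W = 12/25` at rate `log (6/5)`; working row `β_W = 2/5`),
with the counted crossover (theorems only; no new conjecture name)

HONEST FRAMING (cell pub-ymgap, track Y4 / YM3-IR, seat ym3ir-theory-1, gen 14 (staged) / gen 15 (filed, dedup revision); follow-up to `YM3IR/BalabanCeilingsSU3PVW.lean`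
(tier-2 hypothesis-free PV-star W rows, Wilson `2/5`, ball `ClusterDomain κ_b (23/500) (23/1000)`, `κ_b ≥ log (6/5)`) and to
`YM3IR/BalabanCeilingsSU3PV2.lean` (tier-1 hypothesis-free PV2-star rows, Wilson `13/25`), written once engine-2 (g10)'s
`RobustBall/StarRowsSU3PV2WDim3.lean` — the `d = 3` cells of ds-2's WEIGHTED robust vertex-star door in variance form × Bakry–Émery ×
engine-2's CENTRED Schwinger–Dyson one-link variance (PV2), HYPOTHESIS-FREE for `SU(3)` — was in the tree (R212 (iii)).  This file
claims NO summit, NO mass gap and NO part of Bałaban's theorems.  It is kernel-checked BOOKKEEPING: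
`BalabanSUN.massGap3Cofinal_suN_balaban_of_irConjecture3` at `N = 3` with track Y2's input (`ClusterDomainClustering` on a TIER-2 ball
`ClusterDomain κ_b ε₀ ε₁`) DISCHARGED BY NAME by engine-2's hypothesis-free cells
`RobustBall.su3_clusterDomainClusteringW_dim3_pv2Star_oneHalf_t100 κ_b hκb` (tree ceiling `1/6` = Wilson `β_W = 1/2`, ball
`ClusterDomain κ_b (7/125) (7/250)` for EVERY ball parameter `κ_b ≥ 1/100`, rate `1/100` — the highest HYPOTHESIS-FREE `SU(3)` tier-2
`d = 3` ceiling in the tree; radius a door artefact), `RobustBall.su3_clusterDomainClusteringW_dim3_pv2Star_twelveTwentyFifths_w65`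
(tree ceiling `4/25` = Wilson `12/25`, ball `ClusterDomain (log (6/5)) (3/100) (3/200)`, weight AND rate `log (6/5)` — the highest
tier-2 row at the better rate) and the working cell `RobustBall.su3_clusterDomainClusteringW_dim3_pv2Star_twoFifths_t100 κ_b hκb`
(tree `2/15` = Wilson `2/5` on the much larger ball `ClusterDomain κ_b (11/50) (11/100)`, rate `1/100`).  WHAT MOVES on the UV side:
the HYPOTHESIS-FREE `SU(3)` receiving end of the §Y4 sentence ON THE BALL IN WHICH THE CONJECTURE OF RECORD IS TYPED (the weighted
`ClusterDomain κ ε₀ ε₁` of `YM3IR/Statement.lean`) rises from Wilson `2/5` (`BalabanCeilingsSU3PVW`) to `1/2`; the CERTIFIED tier-2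
row GIVEN H1, H2 (`BalabanCeilingsSU3CertifiedW`, Wilson `3/4`) is untouched and remains higher.  Lattice statements only;
strong-coupling constants; no continuum limit, no Millennium claim; no axiom, no `sorry`, no `def`; `0` compute.

THE HYPOTHESIS LIST, VERBATIM (`massGap3Cofinal_su3_W_pv2Star_oneHalf_of_irConjecture3`): `BalabanUV3 mk` — IN PRINT (Bałaban, CMP
102 (1985), Thm 1 p. 257 + Thm 2 p. 272), logically IDLE in the arrow (theory-2 F2; R196); `Nonempty (Family L eps0)` — print's clauses
at one coupling (p. 256 L15–18); `0 < C_b`, `0 < κ`; `1/100 ≤ κ_b` (the ball parameter);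
`IRConjecture3 (ballOfRobustBall 3 κ_b (7/125) (7/250) (1/6)) suFrobDist (fundamentalRep (Fin 3)) (balabanCouplings L (suGroupModel 3)
eps0) C_b κ` — the CONJECTURE of record (theory-2, `YM3IR/Statement.lean`; NOT in print).  LABEL OF RECORD (R196, verbatim): a typed
INTERFACE / dictionary, NOT a reduction — with existential `(C_b, κ)` the free-family conjecture is target-equivalent on every receiving
ball in the tree (theory-2, `YM3IR/ForestWitness.lean`, `YM3IR/ForestWitnessSUN.lean`: the forest witness enters any ball containing
product Haar, the tier-2 balls included, `ForestWitnessSUN.forestWitness3_ball`); the covariant form `IRConjecture3Cov`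
(`YM3IR/CovariantFamily.lean`) is a genuine sufficient condition, possibly strictly stronger, converse NOT known — never "the remaining
gap".  CONCLUSION: `MassGap3Cofinal (balabanCouplings L (suGroupModel 3) eps0) suFrobDist (fundamentalRep (Fin 3))`.

COUNTED CROSSOVER (PROVED arithmetic, tree units `β = β_W/3`): below the ceiling `1/6` after `K + M'` steps iff `L^{M'} ≥ 2/γ₀²`
(the tier-1 working row's `BalabanCeilingsSU3PV2.su3_betaTree_div_pow_le_sixth_iff`, imported and reused BY NAME — the gate's
dedup rule, p370999; not restated here); since `γ₀² ≤ 1` this forces `2 ≤ L^{M'}`, in particular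
`M' ≥ 1` (`su3_row_W_pv2Star_oneHalf_crossover_steps` / `_pos`) — vs `5/(2γ₀²)` at the hypothesis-free tier-2 `2/15`
(`BalabanCeilingsSU3PVW`), `4/(3γ₀²)` at the certified tier-2 `1/4` (`BalabanCeilingsSU3CertifiedW`) and `25/(13γ₀²)` at the
hypothesis-free tier-1 `13/75` (`BalabanCeilingsSU3PV2`).

WHY THIS IS USEFUL (one sentence).  It records, by name and kernel-checked, the §Y4 sentence for the physical colour group on the
weighted ball of `YM3IR/Statement.lean` with Y2's input a HYPOTHESIS-FREE theorem up to Wilson `β_W = 1/2` — the same Wilson value as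
the `SU(2)` tier-2 ceiling (`BalabanCeilingsSU2W`) — and what that leaves for the crossover (`L^{M'} ≥ 2/γ₀²`).

References: T. Bałaban, CMP 102 (1985) 255–275, p. 256 L15–18, (5) p. 256, Thm 1 p. 257, Thm 2 p. 272 [cite: Balaban1985UV3]; CMP 98
(1985) 17–51, (11), (15) p. 19 [cite: Balaban1985Averaging] (block locality = a property of the average (15), no numbered display); H. Shen,
R. Zhu, X. Zhu, CMP 400 (2023) (the vertex σ-model dictionary behind the star rows; engine-2's file header).
-/

noncomputable section

open MeasureTheory
open Literature.MathematicalPhysics.QuantumLattice Literature.MathematicalPhysics.QuantumFieldTheory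
open Balaban1985CMP102 Balaban1985CMP102.Setting Balaban1985CMP102.Theorems
open Literature.MathematicalPhysics.QuantumFieldTheory.Balaban1983to89 (GaugeGroup HaarData)
open Summit.QuantumFields.Balaban3D.Carriers (suGroupModel)

namespace Summit.Ventures.YMGap.YM3IR

open CarrierBridge

/-! ## §1  Wilson `β_W = 1/2` on the weighted ball `ClusterDomain κ_b (7/125) (7/250)`, rate `1/100`, every `κ_b ≥ 1/100` -/

/-- **`SU(3)` lattice YM₃ mass gap on Bałaban's coupling set, receiving on the TIER-2 ball at Wilson `β_W = 1/2`, Y2's input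
HYPOTHESIS-FREE (PROVED bookkeeping).**  engine-2's weighted PV2-star cell
`RobustBall.su3_clusterDomainClusteringW_dim3_pv2Star_oneHalf_t100 κ_b hκb` BY NAME (tree ceiling `1/6`, ball
`ClusterDomain κ_b (7/125) (7/250)` for every `κ_b ≥ 1/100`, rate `1/100`).  The hypothesis that is neither in print nor certified is
`IRConjecture3` (label of record R196: a dictionary, not a reduction; `BalabanUV3 mk` is logically idle).
[cite: Balaban1985UV3, Thm 1 p.257; Thm 2 p.272] -/
theorem massGap3Cofinal_su3_W_pv2Star_oneHalf_of_irConjecture3 {L : ℕ} {mk : Construction L} {eps0 : ℝ → ℝ}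
    (hfam : Nonempty (Family L eps0)) {κ_b C_b κ : ℝ} (hκb : 1 / 100 ≤ κ_b) (hC : 0 < C_b) (hκ : 0 < κ)
    (hUV : BalabanUV3 mk)
    (hIR : IRConjecture3 (ballOfRobustBall 3 κ_b (7 / 125) (7 / 250) (1 / 6)) suFrobDist (fundamentalRep (Fin 3))
      (balabanCouplings L (suGroupModel 3) eps0) C_b κ) :
    MassGap3Cofinal (balabanCouplings L (suGroupModel 3) eps0) suFrobDist
      (fundamentalRep (Fin 3) : RobustBall.SUN 3 →* Matrix (Fin 3) (Fin 3) ℂ) :=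
  massGap3Cofinal_suN_balaban_of_irConjecture3 hfam hC hκ (by norm_num : (0 : ℝ) < 1 / 100) hUV
    (RobustBall.su3_clusterDomainClusteringW_dim3_pv2Star_oneHalf_t100 κ_b hκb).1 hIR

/-- **The COVARIANT §Y4 sentence on the tier-2 ball at Wilson `β_W = 1/2`, Y2's input HYPOTHESIS-FREE (PROVED bookkeeping; the shape
of `BalabanCeilingsSU3PVW.massGap3Cofinal_su3_W_pvStar_twoFifths_of_irConjecture3Cov`, ceiling `2/5 ↦ 1/2`).**  LABEL OF RECORD for
`IRConjecture3Cov` (R196, verbatim): «⟹ target PROVED; converse NOT KNOWN; a genuine sufficient condition, possibly strictly stronger,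
never "the remaining gap"». [cite: Balaban1985Averaging, (11), (15) p.19] -/
theorem massGap3Cofinal_su3_W_pv2Star_oneHalf_of_irConjecture3Cov {L : ℕ} {mk : Construction L} {eps0 : ℝ → ℝ}
    (hfam : Nonempty (Family L eps0)) {κ_b C_b κ : ℝ} (hκb : 1 / 100 ≤ κ_b) (hC : 0 < C_b) (hκ : 0 < κ)
    (hUV : BalabanUV3 mk)
    (hIR : IRConjecture3Cov (ballOfRobustBall 3 κ_b (7 / 125) (7 / 250) (1 / 6)) suFrobDist (fundamentalRep (Fin 3))
      (balabanCouplings L (suGroupModel 3) eps0) C_b κ) :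
    MassGap3Cofinal (balabanCouplings L (suGroupModel 3) eps0) suFrobDist
      (fundamentalRep (Fin 3) : RobustBall.SUN 3 →* Matrix (Fin 3) (Fin 3) ℂ) :=
  massGap3Cofinal_su3_W_pv2Star_oneHalf_of_irConjecture3 hfam hκb hC hκ hUV (irConjecture3_of_cov hIR)

/-- **The same, PRINT-FREE (theory-2's F2 shape: `BalabanUV3 mk` and `mk` deleted; PROVED bookkeeping).**  What remains of print is
the index set `balabanCouplings` and its unboundedness — the kernel record that `BalabanUV3` is evidential in these sentences.
[cite: Balaban1985UV3, p.256 L15–18] -/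
theorem massGap3Cofinal_su3_W_pv2Star_oneHalf_of_irConjecture3Cov_printFree {L : ℕ} {eps0 : ℝ → ℝ}
    (hfam : Nonempty (Family L eps0)) {κ_b C_b κ : ℝ} (hκb : 1 / 100 ≤ κ_b) (hC : 0 < C_b) (hκ : 0 < κ)
    (hIR : IRConjecture3Cov (ballOfRobustBall 3 κ_b (7 / 125) (7 / 250) (1 / 6)) suFrobDist (fundamentalRep (Fin 3))
      (balabanCouplings L (suGroupModel 3) eps0) C_b κ) :
    MassGap3Cofinal (balabanCouplings L (suGroupModel 3) eps0) suFrobDist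
      (fundamentalRep (Fin 3) : RobustBall.SUN 3 →* Matrix (Fin 3) (Fin 3) ℂ) :=
  massGap3Cofinal_of_irConjecture3_printFree (not_bddAbove_balabanCouplings (suGroupModel 3) hfam) hC hκ
    (by norm_num : (0 : ℝ) < 1 / 100) (suFrobDist_bddAbove 3)
    (RobustBall.su3_clusterDomainClusteringW_dim3_pv2Star_oneHalf_t100 κ_b hκb).1 (irConjecture3_of_cov hIR)

/-- **In PRINT'S quantifier order on the tier-2 ball at `β_W = 1/2` (PROVED bookkeeping):** `∃ eps0` first (print, p. 256 L15–18), then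
for every ball parameter `κ_b ≥ 1/100` and every `C_b`, `κ`: `Nonempty (Family L eps0) → IRConjecture3` on the cell's ball (label of
record R196: a dictionary, not a reduction) `⟹ MassGap3Cofinal`. [cite: Balaban1985UV3, p.256 L15–18; Thm 2 p.272] -/
theorem massGap3Cofinal_su3_W_pv2Star_oneHalf_printedOrder_of_irConjecture3 {L : ℕ} (mk : Construction L)
    (hUV : BalabanUV3 mk) :
    ∃ eps0 : ℝ → ℝ, (∀ g : ℝ, 0 < g → 0 < eps0 g) ∧
      (∀ S : Family L eps0, ∀ k, k ≤ S.1.K → (mk (RobustBall.SUN 3) (suGroupModel 3) S.1).ineq41_47 k) ∧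
      ∀ (κ_b C_b κ : ℝ), 1 / 100 ≤ κ_b → 0 < C_b → 0 < κ → Nonempty (Family L eps0) →
        IRConjecture3 (ballOfRobustBall 3 κ_b (7 / 125) (7 / 250) (1 / 6)) suFrobDist (fundamentalRep (Fin 3))
          (balabanCouplings L (suGroupModel 3) eps0) C_b κ →
          MassGap3Cofinal (balabanCouplings L (suGroupModel 3) eps0) suFrobDist
            (fundamentalRep (Fin 3) : RobustBall.SUN 3 →* Matrix (Fin 3) (Fin 3) ℂ) := by
  obtain ⟨eps0, hpos, h2, h⟩ := massGap3Cofinal_suN_balaban_printedOrder_of_irConjecture3 (N := 3) mk hUV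
  refine ⟨eps0, hpos, h2, fun κ_b C_b κ hκb hC hκ hfam hIR => ?_⟩
  exact h (ballOfRobustBall 3 κ_b (7 / 125) (7 / 250) (1 / 6)) C_b κ (1 / 100) hC hκ (by norm_num) hfam
    (RobustBall.su3_clusterDomainClusteringW_dim3_pv2Star_oneHalf_t100 κ_b hκb).1 hIR

/-- At `β⋆ = 1/6` for `SU(3)` (PROVED arithmetic; `γ₀² ≤ 1`; from the tier-1 file's `su3_betaTree_div_pow_le_sixth_iff`, reused by
name): in the window after `K + M'` steps forces `2 ≤ L^{M'}`.
[cite: Balaban1985UV3, (5) p.256] -/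
theorem su3_two_le_pow_of_betaTree_div_pow_le_sixth {L : ℕ} (S : Scales L) (M' : ℕ)
    (h : betaTree (suGroupModel 3) S / (L : ℝ) ^ (S.K + M') ≤ 1 / 6) : (2 : ℝ) ≤ (L : ℝ) ^ M' := by
  have hγ : 0 < Dictionary.gammaSq S := Dictionary.gammaSq_pos S
  have hγ1 : Dictionary.gammaSq S ≤ 1 := Dictionary.gammaSq_le_one S
  have h1 : 2 / Dictionary.gammaSq S ≤ (L : ℝ) ^ M' := (su3_betaTree_div_pow_le_sixth_iff S M').1 h
  have h2 : (2 : ℝ) ≤ 2 / Dictionary.gammaSq S := by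
    rw [le_div_iff₀ hγ]
    nlinarith
  exact h2.trans h1

/-- **The conjecture's counted task on the `SU(3)` tier-2 `β_W = 1/2` row (PROVED arithmetic), at the cell's ball for the record (ball
parameter `κ_b = 1/100`): `2 ≤ L^{M'}`.** [cite: Balaban1985UV3, (5) p.256] -/
theorem su3_row_W_pv2Star_oneHalf_crossover_steps {L : ℕ} (S : Scales L) (M' : ℕ)
    (h : betaTree (suGroupModel 3) S / (L : ℝ) ^ (S.K + M') ≤
      (ballOfRobustBall 3 (1 / 100) (7 / 125) (7 / 250) (1 / 6)).βstar) :
    (2 : ℝ) ≤ (L : ℝ) ^ M' :=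
  su3_two_le_pow_of_betaTree_div_pow_le_sixth S M' h

/-- **Hence still at least ONE block-RG step beyond Bałaban's `K` at `O(1)` effective coupling (`M' ≠ 0`) on the hypothesis-free
tier-2 `SU(3)` `1/2` row, for every admissible `γ₀` (PROVED arithmetic).** [cite: Balaban1985UV3, (5) p.256] -/
theorem su3_row_W_pv2Star_oneHalf_crossover_pos {L : ℕ} (S : Scales L) (M' : ℕ)
    (h : betaTree (suGroupModel 3) S / (L : ℝ) ^ (S.K + M') ≤
      (ballOfRobustBall 3 (1 / 100) (7 / 125) (7 / 250) (1 / 6)).βstar) :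
    M' ≠ 0 := by
  have h2 : (2 : ℝ) ≤ (L : ℝ) ^ M' := su3_row_W_pv2Star_oneHalf_crossover_steps S M' h
  rintro rfl
  norm_num at h2

/-! ## §2  Wilson `β_W = 12/25` at weight AND rate `log (6/5)` on `ClusterDomain (log (6/5)) (3/100) (3/200)` -/

/-- **The §Y4 sentence on the tier-2 ball `ClusterDomain (log (6/5)) (3/100) (3/200)` at Wilson `β_W = 12/25` (tree `4/25`), rate
`log (6/5)`, Y2's input HYPOTHESIS-FREE (PROVED bookkeeping):** engine-2's cell
`RobustBall.su3_clusterDomainClusteringW_dim3_pv2Star_twelveTwentyFifths_w65` BY NAME — the highest hypothesis-free `SU(3)` tier-2 `d = 3`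
row at the rate `log (6/5)` of `BalabanCeilingsSU3PVW` (there `2/5`).  Label of record R196 as in §1. [cite: Balaban1985UV3, Thm 2 p.272] -/
theorem massGap3Cofinal_su3_W_pv2Star_twelveTwentyFifths_w65_of_irConjecture3 {L : ℕ} {mk : Construction L} {eps0 : ℝ → ℝ}
    (hfam : Nonempty (Family L eps0)) {C_b κ : ℝ} (hC : 0 < C_b) (hκ : 0 < κ) (hUV : BalabanUV3 mk)
    (hIR : IRConjecture3 (ballOfRobustBall 3 (Real.log (6 / 5)) (3 / 100) (3 / 200) (4 / 25)) suFrobDist (fundamentalRep (Fin 3))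
      (balabanCouplings L (suGroupModel 3) eps0) C_b κ) :
    MassGap3Cofinal (balabanCouplings L (suGroupModel 3) eps0) suFrobDist
      (fundamentalRep (Fin 3) : RobustBall.SUN 3 →* Matrix (Fin 3) (Fin 3) ℂ) :=
  massGap3Cofinal_suN_balaban_of_irConjecture3 hfam hC hκ RobustBall.log_sixFifths_pos_and_log_threeHalves_pos.1 hUV
    RobustBall.su3_clusterDomainClusteringW_dim3_pv2Star_twelveTwentyFifths_w65.1 hIR

/-- **The COVARIANT form of §2 (PROVED bookkeeping).**  LABEL OF RECORD for `IRConjecture3Cov` (R196, verbatim) as in §1.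
[cite: Balaban1985Averaging, (11), (15) p.19] -/
theorem massGap3Cofinal_su3_W_pv2Star_twelveTwentyFifths_w65_of_irConjecture3Cov {L : ℕ} {mk : Construction L} {eps0 : ℝ → ℝ}
    (hfam : Nonempty (Family L eps0)) {C_b κ : ℝ} (hC : 0 < C_b) (hκ : 0 < κ) (hUV : BalabanUV3 mk)
    (hIR : IRConjecture3Cov (ballOfRobustBall 3 (Real.log (6 / 5)) (3 / 100) (3 / 200) (4 / 25)) suFrobDist (fundamentalRep (Fin 3))
      (balabanCouplings L (suGroupModel 3) eps0) C_b κ) :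
    MassGap3Cofinal (balabanCouplings L (suGroupModel 3) eps0) suFrobDist
      (fundamentalRep (Fin 3) : RobustBall.SUN 3 →* Matrix (Fin 3) (Fin 3) ℂ) :=
  massGap3Cofinal_su3_W_pv2Star_twelveTwentyFifths_w65_of_irConjecture3 hfam hC hκ hUV (irConjecture3_of_cov hIR)

/-! ## §3  Working row: Wilson `β_W = 2/5` on the much larger weighted ball `ClusterDomain κ_b (11/50) (11/100)`, rate `1/100` -/

/-- **The COVARIANT §Y4 sentence on the tier-2 ball `ClusterDomain κ_b (11/50) (11/100)` at Wilson `β_W = 2/5` (tree `2/15`), rate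
`1/100`, every `κ_b ≥ 1/100`, Y2's input HYPOTHESIS-FREE (PROVED bookkeeping):** engine-2's working cell
`RobustBall.su3_clusterDomainClusteringW_dim3_pv2Star_twoFifths_t100 κ_b hκb` BY NAME — at the Wilson value of the `BalabanCeilingsSU3PVW`
ceiling, a ball `(11/50, 11/100)` in place of `(23/500, 23/1000)` (lower rate).  LABEL OF RECORD for `IRConjecture3Cov` (R196, verbatim)
as in §1. [cite: Balaban1985Averaging, (11), (15) p.19] -/
theorem massGap3Cofinal_su3_W_pv2Star_twoFifths_t100_of_irConjecture3Cov {L : ℕ} {mk : Construction L} {eps0 : ℝ → ℝ}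
    (hfam : Nonempty (Family L eps0)) {κ_b C_b κ : ℝ} (hκb : 1 / 100 ≤ κ_b) (hC : 0 < C_b) (hκ : 0 < κ)
    (hUV : BalabanUV3 mk)
    (hIR : IRConjecture3Cov (ballOfRobustBall 3 κ_b (11 / 50) (11 / 100) (2 / 15)) suFrobDist (fundamentalRep (Fin 3))
      (balabanCouplings L (suGroupModel 3) eps0) C_b κ) :
    MassGap3Cofinal (balabanCouplings L (suGroupModel 3) eps0) suFrobDist
      (fundamentalRep (Fin 3) : RobustBall.SUN 3 →* Matrix (Fin 3) (Fin 3) ℂ) :=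
  massGap3Cofinal_suN_balaban_of_irConjecture3 hfam hC hκ (by norm_num : (0 : ℝ) < 1 / 100) hUV
    (RobustBall.su3_clusterDomainClusteringW_dim3_pv2Star_twoFifths_t100 κ_b hκb).1 (irConjecture3_of_cov hIR)

end Summit.Ventures.YMGap.YM3IR

end
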